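import Summits.Langlands.Langlands.Theses.DyadicOddResidue
import Literature.NumberTheory.Automorphic.IsAutomorphicAE
import Literature.NumberTheory.Automorphic.GLnAdelicStructureProofs
import Literature.NumberTheory.GaloisRepresentations.CalegariEvenFontaineMazurTwo
import Literature.FieldTheory.AlgClosed.PadicAlgClEquivComplex
import Literature.RepresentationTheory.Semisimple.BurnsideMatrixSpan

/-!
# Disproof of `DyadicEisensteinFM` (stmt-Langlands-18741) — findings

Standing crux-disprover work file (cdisprove, route `DyadicOddResidue`, opened 2026-08-17,
refuter-cdisprove-stmt-Langlands-18741-0, cycle 1).  Prose lives in docstrings only.  Sibling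
file for K3 of the same route: `Cruxes/DyadicNonsolvableFM/Disproof.lean` (its §0–§3 transfer
verbatim to this crux wherever the residual hypothesis plays no role; not re-proved here except
where the proof is one line).

## Verdict of cycle 1: NO KILL — the crux is a typed rendering of an OPEN PRINTED QUESTION

`DyadicEisensteinFM` = Fontaine–Mazur modularity over `ℚ` at `ℓ = 2` for continuous
`ρ : Γ_ℚ → GL₂(ℚ̄₂)` which are NOT residually absolutely irreducible (`ρ̄^ss = χ̄₁ ⊕ χ̄₂`, the
Eisenstein residue), irreducible, odd, unramified a.e., de Rham at `2` (Fontaine's pinned datum)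
with distinct labelled Hodge–Tate weights ⟹ `∀ hcpt ι, IsAutomorphicAE ι hcpt ρ` (definitionally,
`automorphicAE_iff`).  In print this is the question left open by Pan (JAMS 35 (2022), Thm. 1.0.2,
"`p` odd"), X. Zhang (arXiv:2412.06812, Thm. 1.0.2, `p = 3`; arXiv:2512.21249, Dec 2025, "let
`p ≥ 3` be an odd prime" throughout — grep of the held text, pp. 27–31) and Paškūnas–Tung (Forum
Math. Sigma 9 (2021) e80, §1.2 p. 6, "it seems likely that … one can remove the restriction on
the prime `p`").  Literature re-check 2026-08-17 (arXiv API: "Fontaine-Mazur p=2" 1 hit, unrelated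
— Feuerpfeil 2026, tame FM; S2: Pan 2019/2022, Zhang 2024/2025 (`p ≥ 3`), Berger 2017 (polarised,
CM), Paškūnas–Tung 2021; OpenAlex 429): nothing settles `p = 2` in the residually reducible case —
BUT ONE SUB-CELL IS NOW PRINTED (found through the crux's idea cards, confirmed on the held text):
J. A. Thorne, *Towards the Fontaine–Mazur conjecture for GL(2)*, arXiv:2608.07186 (7 Aug 2026),
**Theorem D** (p. 3): "Let `p` be a prime, and let `ρ : G_ℚ → GL₂(ℚ̄_p)` be continuous, irreducible,
(1) unramified at all but finitely many primes, (2) `ρ|_{G_{ℚ_p}}` potentially crystalline and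
ORDINARY of Hodge–Tate weights `{0,1}`, (3) `det ρ` odd. Then `ρ` is modular" — "which applies in
particular in the open case `p = 2`, `ρ̄` reducible" (ibid.); p. 2 also prints the status this route
relies on ("Conjecture C is known when `p ≥ 3` [Pan22, Zha25], and when `p = 2`, provided that `ρ̄`
is irreducible, with non-solvable image [Tun21]").  So the potentially-crystalline-ordinary
weight-`{0,1}` cell of THIS crux is a CITE (kill criterion (1) of the route, partially): planners
may split K1 into that cell (support, printed) and the remainder (non-ordinary, or weights ≠ `{0,1}`
up to twist, or not potentially crystalline), which stays OPEN.  A `¬`-theorem of the crux would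
still be a counterexample to the Fontaine–Mazur conjecture itself.

## Why no Lean refutation is available (resists because …)

`¬ DyadicEisensteinFM` needs a WITNESS `ρ : FramedGaloisRep ℚ (PadicAlgCl 2) 2` meeting six
honest hypotheses (the tree's `IsIrreducible`, `IsOdd`, `IsUnramifiedAt`, `IsDeRhamFramed` for the
PINNED Fontaine datum, `labelledHodgeTateWeightsAt`, `IsResiduallyAbsIrreducible` are all genuine —
read back symbol by symbol, no junk operator, no degenerate parameter: `n = 2`, `K = ℚ` are fixed,
`ℓ = 2` is substituted, `hcpt` is PROVED (`isCompact_glFiniteIntegralLevel_holds`) and `ι` EXISTS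
(`PadicAlgCl.nonempty_ringEquiv_complex`), so neither universal binder is vacuous) together with a
proof that NO cuspidal L-algebraic `π` of `GL₂(𝔸_ℚ)` is Satake-compatible with it a.e. — a
statement about ALL inhabitants of the honest interface `CuspidalAutomorphicRepData 2 ℚ hcpt`
(Borel–Jacquet cusp forms), unprovable without analytic named facts (Jacquet–Shalika) and, for
any `ρ` in the crux's scope, FALSE in nature as far as anyone knows.  Consistency on the modular
locus (pen and paper, the planner's falsifier (2)): `ρ_{Δ,2}` (level 1, weight 12, `ρ̄^ss = 1 ⊕ 1`)
and `ρ_{f,2}`, `f` = 11a (weight 2, `ρ̄` reducible) satisfy every hypothesis, and the conclusion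
holds with `π = π_f^u ⊗ |det|^{(k-1)/2}`: L-algebraic (exponents `{0, k-1} ⊂ ℤ`), Satake parameter
`α = {α₁ p^{-(k-1)/2}, α₂ p^{-(k-1)/2}}`, and `arithFrobPolyOfSatake ι p 1 α = ∏ (X - ι⁻¹(α_j⁻¹)) =
X² - a_p X + p^{k-1}` = the ARITHMETIC Frobenius polynomial of `ρ_f` (DDT Thm. 3.1) — the
L-normalisation of `SatakeFrobCompatibleAt` is consistent; no misstatement there.

## Contents (all `sorry`-free)

* §0 CHARACTERISTIC-2 LEMMAS (the formal content of "oddness is residually invisible at `2`",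
  the first obstruction named by the route): in characteristic `2` an involution is unipotent
  (`matrix_sub_one_mul_self_eq_zero`), so for EVERY homomorphism `τ : Γ_K → GL_n(k)`, `char k = 2`
  — in particular every reduction / residual representation of every `ρ : Γ_K → GL_n(ℚ̄₂)`, odd
  OR even — and every complex conjugation `c`: `(τ(c) - 1)² = 0` and `det τ(c) = 1`
  (`residual_complexConjugation_unipotent`, `residual_det_complexConjugation_eq_one`).  Contrast,
  any `ℓ`: a reduction of an ODD `ρ` has `det τ(c) = -1` (`det_reduction_complexConjugation`), hence
  `τ(c) ≠ 1` as soon as `char k ≠ 2` (`reduction_complexConjugation_ne_one`) — the DDT /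
  Skinner–Wiles splitting input, which is exactly what is lost at `ℓ = 2`.  Second obstruction
  typed: `ω̄₂ = 1` (`modPCyclotomicCharacterZMod_two_eq_one`, `(ℤ/2)ˣ = 1`), and every mod-`2`
  character kills complex conjugation (`character_complexConjugation_eq_one`), so on the
  Eisenstein residue `ρ̄^ss(c) = 1` and the blocks `1`, `ω̄^{±1}` coincide.
* §1 `DyadicEisensteinFMAtTwo`, `dyadicEisensteinFM_iff_atTwo` (the `∀ ℓ, ℓ = 2 →` binder is
  cosmetic); clause abbreviations `AEUnramified`, `DeRhamRegularAtTwo`, `AutomorphicAE`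
  (`automorphicAE_iff`); `not_isResiduallyAbsIrreducible_iff` (what `hres` says).
  §1b TRACE CRITERION for `hres` (non-vacuity direction): Burnside–Kolchin
  (`eq_one_of_isAbsIrreducible_of_trace_const`: abs. irreducible + constant trace ⟹ trivial;
  `not_isAbsIrreducible_of_trace_const`), `trace_reduction`, and
  `not_isResiduallyAbsIrreducible_of_trace_sub_mem`: `tr ρ ≡ c (mod 𝔪)` ⟹ `hres`; at `ℓ = 2`,
  "all traces in `𝔪`" (e.g. `ρ_{Δ,2}`) ⟹ `hres`.
* LANDED under `Theorems/DyadicEisensteinFM/Negative/`: `OddnessResiduallyInvisible.lean`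
  (p145404), `ConclusionForcesUnramified.lean` (p147044), `ResidualCharactersAtTwo.lean` (p147047),
  `EisensteinResidueTraceCriterion.lean` (p147052) — all four ACCEPTED (2026-08-17); later cycles
  may import them here and drop the duplicated §0/§1b proofs.
* §2 HYPOTHESIS MUTATION: unlike K3 (`DyadicNonsolvableFM`, where `hres`, `hirr` are implied by
  `hsol`), here the six hypotheses are pairwise independent in nature; no implication is provable
  and none is claimed.  `IsOdd` is INVISIBLE residually (§0) but not droppable (see §3).
* §3 LOAD-BEARING ANALYSIS, as `def …Without<H> : Prop` with status:
  - `hres` dropped: `withoutResiduallyReducible_iff` — EXACTLY `DyadicEisensteinFM ∧ DyadicDihedralFM ∧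
    DyadicNonsolvableFM` (the trichotomy of `closes`): load-bearing modulo the open K2, never
    refutable short of a counterexample to Fontaine–Mazur.
  - `hirr` dropped: `withoutIrreducible_iff` — the crux PLUS "every REDUCIBLE odd a.e.-unramified
    dR-regular residually-reducible `ρ` is cuspidal-automorphic", which is FALSE in nature
    (`ρ = 1 ⊕ ε₂`: `π` would have Satake parameters `{p^{1/2}, p^{-1/2}}` after unitary twist, the
    boundary excluded by Jacquet–Shalika for cuspidal `π`); K1-specific and genuinely load-bearing
    (for K3 it was decoration).  No witness is constructible yet: see the NEAR-MISS block of §5.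
  - `hodd` dropped: OPEN, conjecturally true for want of instances (even regular geometric `ρ` should
    not exist; Calegari 2011/2012 need `p > 7` and big residual image — nothing at `ℓ = 2`,
    `ρ̄` reducible); load-bearing for every known METHOD, invisible residually (§0).
  - de Rham / `Nodup` dropped: false in print (non-de Rham points of the Eisenstein deformation
    space), no witness in the tree; `Nodup` alone dropped = weight-one / Artin FM at `2`, open.
  - a.e.-unramified dropped: `aeUnramified_of_automorphicAE` (UNCONDITIONAL: `hcpt`, `ι` are
    instantiated in-tree) and `withoutAEUnramified_iff`: the conclusion re-implies the hypothesis,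
    so dropping it asserts a.e.-unramifiedness of arbitrary such `ρ` — false in nature
    (infinitely ramified representations, Ramakrishna 2000 / Khare–Larsen–Ramakrishna 2005), no
    dyadic Eisenstein witness in print.
* §4 SHAPE OF THE CONCLUSION: `not_satakeFrobCompatibleAt_of_not_isUnramifiedAt` — the `∀ᶠ v` of
  the conclusion cannot be upgraded to `∀ v` for any `ρ` ramified somewhere (tightness of the
  almost-everywhere form).
* §5 NEAR-MISSES / what a prover of `¬ …WithoutIrreducible` would have to build (docstring only; no
  `sorry` is left in this file).
* §6 `-- Targets`: none (payload `stuck_stubs = []`, no skeleton registered: PICKED.md records the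
  ideation sketch `SketchIdeator2.lean` as not a line).
-/

set_option linter.dupNamespace false -- project-wide option; `Summit.Langlands.Langlands` is the mandated namespace

noncomputable section

open scoped MatrixGroups
open Matrix NumberField IsDedekindDomain Filter
open Literature.NumberTheory.GaloisRepresentations Literature.NumberTheory.Automorphic
open Summit.Langlands Summit.Langlands.Langlands.Theses.DyadicOddResidue

namespace Summit.Langlands.Langlands.Cruxes.DyadicEisensteinFM.Disproof

/-! ## §0 Characteristic `2`: complex conjugation is residually unipotent -/

section CharTwo

variable {k : Type*} [Field k]

/-- **In characteristic `2` an involution is unipotent**: `A² = 1 ⟹ (A - 1)² = A² - 2A + 1 = 0`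
for square matrices over a field of characteristic `2`. [folklore] -/
theorem matrix_sub_one_mul_self_eq_zero [CharP k 2] {m : Type*} [Fintype m] [DecidableEq m]
    (A : Matrix m m k) (hA : A * A = 1) : (A - 1) * (A - 1) = 0 := by
  have h : (A - 1) * (A - 1) = A * A + 1 - (A + A) := by noncomm_ring
  have h2 : A + A = 0 := by
    ext i j
    simp [CharTwo.add_self_eq_zero]
  have h1 : (1 : Matrix m m k) + 1 = 0 := by
    ext i j
    by_cases hij : i = j
    · subst hij
      simp [CharTwo.add_self_eq_zero]
    · simp [hij]
  rw [h, hA, h2, sub_zero, h1]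

/-- For a homomorphism `τ : G → GL_n(k)`, `char k = 2`, and `c ∈ G` with `c² = 1`:
`(τ(c) - 1)² = 0` (as matrices). [folklore] -/
theorem gl_sub_one_mul_self_eq_zero [CharP k 2] {G : Type*} [Group G] {n : ℕ}
    (τ : G →* GL (Fin n) k) {c : G} (hc : c ^ 2 = 1) :
    (((τ c : GL (Fin n) k) : Matrix (Fin n) (Fin n) k) - 1) *
      (((τ c : GL (Fin n) k) : Matrix (Fin n) (Fin n) k) - 1) = 0 := by
  apply matrix_sub_one_mul_self_eq_zero
  rw [← Matrix.GeneralLinearGroup.coe_mul, ← map_mul, ← pow_two, hc, map_one,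
    Matrix.GeneralLinearGroup.coe_one]

/-- For a homomorphism `τ : G → GL_n(k)`, `char k = 2`, and `c ∈ G` with `c² = 1`:
`det τ(c) = 1` (`x² = 1 ⟹ (x - 1)² = 0 ⟹ x = 1` in a field of characteristic `2`). [folklore] -/
theorem gl_det_eq_one_of_sq_eq_one [CharP k 2] {G : Type*} [Group G] {n : ℕ}
    (τ : G →* GL (Fin n) k) {c : G} (hc : c ^ 2 = 1) :
    Matrix.GeneralLinearGroup.det (τ c) = 1 := by
  have hu : Matrix.GeneralLinearGroup.det (τ c) ^ 2 = 1 := by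
    rw [← map_pow, ← map_pow, hc, map_one, map_one]
  set x : k := ((Matrix.GeneralLinearGroup.det (τ c) : kˣ) : k) with hxdef
  have hx : x ^ 2 = 1 := by
    have h := congrArg Units.val hu
    simpa [hxdef] using h
  have h0 : (x - 1) ^ 2 = 0 := by
    rw [sub_sq, hx, CharTwo.two_eq_zero, zero_mul, zero_mul, sub_zero, one_pow,
      CharTwo.add_self_eq_zero]
  have hx1 : x = 1 := sub_eq_zero.mp ((pow_eq_zero_iff two_ne_zero).mp h0)
  exact Units.ext (by rw [Units.val_one]; exact hx1)

/-- Any field receiving the residue field `ℤ̄₂/𝔪` of `ℚ̄₂` has characteristic `2`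
(`charP_padicAlgClResidueField`, `charP_of_injective_ringHom`). [folklore] -/
theorem charP_two_of_residueField_ringHom (ι : padicAlgClResidueField 2 →+* k) : CharP k 2 :=
  haveI := charP_padicAlgClResidueField 2
  charP_of_injective_ringHom ι.injective 2

/-- **Complex conjugation is residually unipotent at `ℓ = 2`.**  For every field `K` with a real
embedding `φ`, every complex conjugation `c` for `φ` (`IsComplexConjugation`, an involution:
`IsComplexConjugation.sq_eq_one`), every field `k` of characteristic `2` and EVERY homomorphism
`τ : Γ_K → GL_n(k)` — in particular every reduction and every residual representation, along any
`ι : ℤ̄₂/𝔪 →+* k`, of every `ρ : Γ_K → GL_n(ℚ̄₂)`, odd or even —: `(τ(c) - 1)² = 0`.  So `τ(c)` is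
`1` or (for `n = 2`) conjugate to `(1 1; 0 1)`; on a SEMISIMPLE `τ` whose image is abelian (the
Eisenstein residue `χ̄₁ ⊕ χ̄₂` of this crux) `τ(c) = 1` outright.  This is the formal content of
the route's first obstruction ("mod 2 oddness is invisible, `ρ̄(c) = 1` possible"): the
Skinner–Wiles / Bellaïche–Chenevier splitting of the residual pseudo-representation by the
eigenvalues `±1` of `ρ(c)` has nothing to split. [folklore] -/
theorem residual_complexConjugation_unipotent {K : Type*} [Field K] [CharP k 2] {n : ℕ}
    (τ : Field.absoluteGaloisGroup K →* GL (Fin n) k) {φ : K →+* ℝ}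
    {c : Field.absoluteGaloisGroup K} (hc : IsComplexConjugation φ c) :
    (((τ c : GL (Fin n) k) : Matrix (Fin n) (Fin n) k) - 1) *
      (((τ c : GL (Fin n) k) : Matrix (Fin n) (Fin n) k) - 1) = 0 :=
  gl_sub_one_mul_self_eq_zero τ hc.sq_eq_one

/-- **`det ρ̄(c) = 1` at `ℓ = 2`, for every mod-`2` representation, odd or even**: the residual
determinant of complex conjugation carries no sign. [folklore] -/
theorem residual_det_complexConjugation_eq_one {K : Type*} [Field K] [CharP k 2] {n : ℕ}
    (τ : Field.absoluteGaloisGroup K →* GL (Fin n) k) {φ : K →+* ℝ}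
    {c : Field.absoluteGaloisGroup K} (hc : IsComplexConjugation φ c) :
    Matrix.GeneralLinearGroup.det (τ c) = 1 :=
  gl_det_eq_one_of_sq_eq_one τ hc.sq_eq_one

/-- The same for reductions of `ρ : Γ_K → GL_n(ℚ̄₂)` along any residue embedding
`ι : ℤ̄₂/𝔪 →+* k` (the characteristic of `k` is then `2`): whatever the parity of `ρ`, every
reduction `τ` of `ρ` has `det τ(c) = 1` and unipotent `τ(c)`. [folklore] -/
theorem reduction_two_complexConjugation {K : Type*} [Field K] {n : ℕ}
    (ρ : FramedGaloisRep K (PadicAlgCl 2) n) (ι : padicAlgClResidueField 2 →+* k)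
    {τ : Field.absoluteGaloisGroup K →* GL (Fin n) k} (_hτ : ρ.IsReductionOf ι τ) {φ : K →+* ℝ}
    {c : Field.absoluteGaloisGroup K} (hc : IsComplexConjugation φ c) :
    Matrix.GeneralLinearGroup.det (τ c) = 1 ∧
      (((τ c : GL (Fin n) k) : Matrix (Fin n) (Fin n) k) - 1) *
        (((τ c : GL (Fin n) k) : Matrix (Fin n) (Fin n) k) - 1) = 0 :=
  haveI := charP_two_of_residueField_ringHom ι
  ⟨residual_det_complexConjugation_eq_one τ hc, residual_complexConjugation_unipotent τ hc⟩

/-- `(ℤ/2)ˣ` is trivial. [folklore] -/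
theorem units_zmod_two_eq_one (u : (ZMod 2)ˣ) : u = 1 := by
  revert u
  decide

/-- **`ω̄ ≡ 1` at `ℓ = 2`** (the route's second obstruction, "`ω ≡ 1 (mod 2)` makes every
reducible block exceptional"): the mod-`2` cyclotomic character of ANY field of characteristic
`≠ 2` is trivial, because it takes values in `(ℤ/2)ˣ = 1`.  So in the Eisenstein residue
`ρ̄^ss = χ̄₁ ⊕ χ̄₂` of this crux the Paškūnas trichotomy `χ̄₁χ̄₂⁻¹ ∈ {1, ω̄^{±1}}` / generic
collapses to `χ̄₁ = χ̄₂` / `χ̄₁ ≠ χ̄₂`, and `1`, `ω̄` are the same block. [folklore] -/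
theorem modPCyclotomicCharacterZMod_two_eq_one (K : Type*) [Field K] [NeZero ((2 : ℕ) : K)] :
    modPCyclotomicCharacterZMod K 2 = 1 :=
  MonoidHom.ext fun σ => by
    rw [MonoidHom.one_apply]
    exact units_zmod_two_eq_one _

/-- In particular over `ℚ`: `ω̄₂ = 1` on `Γ_ℚ`. [folklore] -/
theorem modPCyclotomicCharacterZMod_two_rat : modPCyclotomicCharacterZMod ℚ 2 = 1 :=
  modPCyclotomicCharacterZMod_two_eq_one ℚ

/-- **Mod-`2` characters see no sign either**: every `kˣ`-valued character (`char k = 2`) is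
trivial on every involution, in particular on complex conjugation — the rank-one case of
`gl_det_eq_one_of_sq_eq_one` (`x² = 1 ⟹ x = 1`).  So the residual characters `χ̄₁, χ̄₂` of the
Eisenstein residue satisfy `χ̄ᵢ(c) = 1`: `ρ̄^ss(c) = 1`. [folklore] -/
theorem character_complexConjugation_eq_one {K : Type*} [Field K] [CharP k 2]
    (χ : Field.absoluteGaloisGroup K →* kˣ) {φ : K →+* ℝ} {c : Field.absoluteGaloisGroup K}
    (hc : IsComplexConjugation φ c) : χ c = 1 := by
  have hu : χ c ^ 2 = 1 := by rw [← map_pow, hc.sq_eq_one, map_one]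
  set x : k := ((χ c : kˣ) : k) with hxdef
  have hx : x ^ 2 = 1 := by
    have h := congrArg Units.val hu
    simpa [hxdef] using h
  have h0 : (x - 1) ^ 2 = 0 := by
    rw [sub_sq, hx, CharTwo.two_eq_zero, zero_mul, zero_mul, sub_zero, one_pow,
      CharTwo.add_self_eq_zero]
  have hx1 : x = 1 := sub_eq_zero.mp ((pow_eq_zero_iff two_ne_zero).mp h0)
  exact Units.ext (by rw [Units.val_one]; exact hx1)

end CharTwo

/-! ### Contrast (any `ℓ`): what oddness DOES give residually when `char k ≠ 2` -/

section AnyPrime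

variable {F : Type*} [Field F] {O : ValuationSubring F} {n : ℕ} {G : Type*} [Group G]
  {k : Type*} [Field k]

/-- **The determinant of a reduction is the reduction of the determinant**: if `τ` is a reduction
of `ρ : G → GL_n(F)` along `ι : O/𝔪 →+* k` (`IsReductionOf`: `τ = Q (ρ₀ mod 𝔪) Q⁻¹`,
`ρ₀ = P⁻¹ ρ P` integral), then for every `g` there is a unit `d ∈ Oˣ` (namely `det ρ₀(g)`) with
`d = det ρ(g)` in `F` and `det τ(g) = ι(d mod 𝔪)`. [folklore] -/
theorem det_reduction {ι : IsLocalRing.ResidueField O →+* k} {ρ : G →* GL (Fin n) F}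
    {τ : G →* GL (Fin n) k}
    (h : Literature.NumberTheory.GaloisRepresentations.IsReductionOf ι ρ τ) (g : G) :
    ∃ d : Oˣ, Units.map (O.subtype : O →* F) d = Matrix.GeneralLinearGroup.det (ρ g) ∧
      Matrix.GeneralLinearGroup.det (τ g) =
        Units.map ((ι.comp (IsLocalRing.residue O) : O →+* k) : O →* k) d := by
  obtain ⟨ρ₀, Q, ⟨P, hP⟩, hQ⟩ := h
  refine ⟨Matrix.GeneralLinearGroup.det (ρ₀ g), ?_, ?_⟩
  · rw [← Matrix.GeneralLinearGroup.map_det, hP g, map_mul, map_mul, map_inv, inv_mul_cancel_comm]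
  · rw [hQ g, map_mul, map_mul, map_inv, mul_inv_cancel_comm]
    exact Matrix.GeneralLinearGroup.map_det _ _

/-- **A reduction of an odd representation is odd**: for `ρ : Γ_K → GL_n(ℚ̄_ℓ)` odd, every
reduction `τ` along any `ι : ℤ̄_ℓ/𝔪 →+* k` and every complex conjugation `c`:
`det τ(c) = -1` in `k`.  (At `ℓ = 2` this says `det τ(c) = 1`, cf.
`residual_det_complexConjugation_eq_one`.) [folklore] -/
theorem det_reduction_complexConjugation {K : Type*} [Field K] {ℓ : ℕ} [Fact ℓ.Prime]
    {ρ : FramedGaloisRep K (PadicAlgCl ℓ) n} (hodd : ρ.IsOdd) {ι : padicAlgClResidueField ℓ →+* k}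
    {τ : Field.absoluteGaloisGroup K →* GL (Fin n) k} (hτ : ρ.IsReductionOf ι τ) {φ : K →+* ℝ}
    {c : Field.absoluteGaloisGroup K} (hc : IsComplexConjugation φ c) :
    ((Matrix.GeneralLinearGroup.det (τ c) : kˣ) : k) = -1 := by
  obtain ⟨d, hd, hτd⟩ := det_reduction hτ c
  have hρ : Matrix.GeneralLinearGroup.det
      ((ρ : Field.absoluteGaloisGroup K →* GL (Fin n) (PadicAlgCl ℓ)) c) = -1 := hodd φ c hc
  rw [hρ] at hd
  have hdF : ((d : padicAlgClIntegers ℓ) : PadicAlgCl ℓ) = -1 := by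
    have h := congrArg Units.val hd
    rw [Units.coe_map] at h
    simpa using h
  have hdO : (d : padicAlgClIntegers ℓ) = -1 := by
    apply Subtype.val_injective
    simpa using hdF
  rw [hτd, Units.coe_map]
  simp [hdO]

/-- **… hence `τ(c) ≠ 1` whenever `char k ≠ 2`** (in particular for every odd prime `ℓ`, where
`char k = ℓ`): complex conjugation is residually a NON-TRIVIAL semisimple involution with
eigenvalues `1, -1` — the splitting used by Skinner–Wiles (Publ. IHÉS 89, §2) and
Bellaïche–Chenevier for residually reducible odd `ρ` at odd `ℓ`, unavailable at `ℓ = 2` by §0.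
[folklore] -/
theorem reduction_complexConjugation_ne_one {K : Type*} [Field K] {ℓ : ℕ} [Fact ℓ.Prime]
    {ρ : FramedGaloisRep K (PadicAlgCl ℓ) n} (hodd : ρ.IsOdd) {ι : padicAlgClResidueField ℓ →+* k}
    (hk : ringChar k ≠ 2) {τ : Field.absoluteGaloisGroup K →* GL (Fin n) k}
    (hτ : ρ.IsReductionOf ι τ) {φ : K →+* ℝ} {c : Field.absoluteGaloisGroup K}
    (hc : IsComplexConjugation φ c) : τ c ≠ 1 := by
  intro h1
  have h := det_reduction_complexConjugation hodd hτ hc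
  rw [h1, map_one, Units.val_one] at h
  exact Ring.neg_one_ne_one_of_char_ne_two hk h.symm

end AnyPrime

/-! ## §1 The crux at the literal prime `2`; clause abbreviations -/

/-- Clause "unramified at all but finitely many places" of the crux (at `ℓ = 2`). -/
def AEUnramified (ρ : FramedGaloisRep ℚ (PadicAlgCl 2) 2) : Prop :=
  ∀ᶠ v : HeightOneSpectrum (𝓞 ℚ) in cofinite, ρ.IsUnramifiedAt v

/-- Clause "de Rham at `2` for Fontaine's pinned datum, with multiplicity-free labelled
Hodge–Tate weights" of the crux (at `ℓ = 2`). -/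
def DeRhamRegularAtTwo (ρ : FramedGaloisRep ℚ (PadicAlgCl 2) 2) : Prop :=
  ∀ (v : HeightOneSpectrum (𝓞 ℚ)) (hv : ((2 : ℕ) : 𝓞 ℚ) ∈ v.asIdeal),
    (Literature.NumberTheory.PAdicHodge.fontainePstAdicCompletion v 2 hv).IsDeRhamFramed
        (ρ.toLocal v) ∧
      ∀ τ : v.adicCompletion ℚ →+* PadicAlgCl 2, Continuous τ →
        (ρ.labelledHodgeTateWeightsAt v
          (Literature.NumberTheory.PAdicHodge.fontainePstAdicCompletion v 2 hv).algebra
          (Literature.NumberTheory.PAdicHodge.fontainePstAdicCompletion v 2 hv).𝔅 τ).Nodup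

/-- The conclusion of the crux (at `ℓ = 2`): for every level witness `hcpt` and every
`ι : ℚ̄₂ ≃ ℂ`, `ρ` is Satake–Frobenius compatible a.e. with an L-algebraic cuspidal `π` of
`GL₂(𝔸_ℚ)` — definitionally `∀ hcpt ι, IsAutomorphicAE ι hcpt ρ` (`automorphicAE_iff`). -/
def AutomorphicAE (ρ : FramedGaloisRep ℚ (PadicAlgCl 2) 2) : Prop :=
  ∀ (hcpt : isCompact_glFiniteIntegralLevel 2 ℚ) (ι : PadicAlgCl 2 ≃+* ℂ),
    ∃ π : CuspidalAutomorphicRepData 2 ℚ hcpt, π.1.IsLAlgebraic ∧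
      ∀ᶠ v : HeightOneSpectrum (𝓞 ℚ) in cofinite, SatakeFrobCompatibleAt ι π.1 ρ v

/-- The conclusion is the accepted automorphy clause `IsAutomorphicAE` (definitional). -/
theorem automorphicAE_iff (ρ : FramedGaloisRep ℚ (PadicAlgCl 2) 2) :
    AutomorphicAE ρ ↔
      ∀ (hcpt : isCompact_glFiniteIntegralLevel 2 ℚ) (ι : PadicAlgCl 2 ≃+* ℂ),
        IsAutomorphicAE ι hcpt ρ :=
  Iff.rfl

/-- **The crux at the literal prime `2`** (the binder `∀ ℓ [Fact ℓ.Prime], ℓ = 2 →` of the route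
file is cosmetic: `dyadicEisensteinFM_iff_atTwo`). -/
def DyadicEisensteinFMAtTwo : Prop :=
  ∀ ρ : FramedGaloisRep ℚ (PadicAlgCl 2) 2, ¬ ρ.IsResiduallyAbsIrreducible →
    ρ.toGaloisRep.IsIrreducible → ρ.IsOdd → AEUnramified ρ → DeRhamRegularAtTwo ρ →
      AutomorphicAE ρ

/-- The route decl `DyadicEisensteinFM` is equivalent to its `ℓ := 2` instance. -/
theorem dyadicEisensteinFM_iff_atTwo : DyadicEisensteinFM ↔ DyadicEisensteinFMAtTwo := by
  constructor
  · intro h ρ hres hirr hodd hunr hdR hcpt ι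
    exact h 2 rfl ρ hres hirr hodd hunr hdR hcpt ι
  · intro h ℓ _ hℓ ρ hres hirr hodd hunr hdR hcpt ι
    subst hℓ
    exact h ρ hres hirr hodd hunr hdR hcpt ι

/-- **What `hres` says.**  `¬ ρ.IsResiduallyAbsIrreducible` unfolds to: EVERY reduction
`τ : Γ_ℚ → GL₂(ℤ̄₂/𝔪)` of `ρ` (every `Γ_ℚ`-stable lattice) fails to be absolutely irreducible,
i.e. becomes reducible over some field extension — for the algebraically closed `ℤ̄₂/𝔪` this is
"`ρ̄^ss = χ̄₁ ⊕ χ̄₂`", the Eisenstein residue.  (The tree's Burnside bridge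
`hasAbsolutelyIrreducibleReduction_iff_isResiduallyAbsIrreducible` identifies the positive form
with DDT's.) [folklore] -/
theorem not_isResiduallyAbsIrreducible_iff (ρ : FramedGaloisRep ℚ (PadicAlgCl 2) 2) :
    ¬ ρ.IsResiduallyAbsIrreducible ↔
      ∀ τ : Field.absoluteGaloisGroup ℚ →* GL (Fin 2) (padicAlgClResidueField 2),
        ρ.IsReductionOf (RingHom.id _) τ → ¬ IsAbsIrreducible τ := by
  constructor
  · intro h τ hτ habs
    exact h ⟨τ, hτ, habs⟩
  · rintro h ⟨τ, hτ, habs⟩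
    exact h τ hτ habs

/-! ### §1b A trace criterion for `hres` (non-vacuity direction; landed as
`Theorems/DyadicEisensteinFM/Negative/EisensteinResidueTraceCriterion.lean`)

Burnside–Kolchin: an absolutely irreducible `τ : G → GL_n(k)` with CONSTANT trace is trivial, so
for `n ≥ 2` constant trace excludes absolute irreducibility; traces of reductions are reductions
of traces; hence `tr ρ(g) ≡ c (mod 𝔪)` for all `g` ⟹ `¬ ρ.IsResiduallyAbsIrreducible`.  At
`ℓ = 2`, `c ≡ tr 1 = 0`: every `ρ` with all traces in `𝔪` (`ρ̄^ss = χ̄ ⊕ χ̄`, e.g. `ρ_{Δ,2}`: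
`τ(p) ≡ 1 + p¹¹ ≡ 0 (mod 2)`) meets `hres` by a trace congruence alone. -/

section Burnside

universe u

variable {k : Type u} [Field k] {G : Type*} [Group G] {n : ℕ}

/-- For `τ : G → GL_n(k)` with constant trace and `u = τ(g₀)`, the functional `M ↦ tr((u - 1)M)`
vanishes on the `k`-span of `τ(G)`. [folklore] -/
theorem trace_sub_one_mul_eq_zero_of_trace_const (τ : G →* GL (Fin n) k) (c : k)
    (htr : ∀ g, ((τ g : GL (Fin n) k) : Matrix (Fin n) (Fin n) k).trace = c) (g₀ : G)
    (M : Matrix (Fin n) (Fin n) k)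
    (hM : M ∈ Submodule.span k
      (Set.range fun g => ((τ g : GL (Fin n) k) : Matrix (Fin n) (Fin n) k))) :
    ((((τ g₀ : GL (Fin n) k) : Matrix (Fin n) (Fin n) k) - 1) * M).trace = 0 := by
  induction hM using Submodule.span_induction with
  | mem x hx =>
    obtain ⟨g, rfl⟩ := hx
    rw [sub_mul, one_mul, Matrix.trace_sub, ← Matrix.GeneralLinearGroup.coe_mul, ← map_mul, htr,
      htr, sub_self]
  | zero => rw [mul_zero, Matrix.trace_zero]
  | add x y _ _ hx hy => rw [mul_add, Matrix.trace_add, hx, hy, add_zero]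
  | smul a x _ hx => rw [Matrix.mul_smul, Matrix.trace_smul, hx, smul_zero]

/-- **Burnside–Kolchin**: for `n ≥ 1`, an absolutely irreducible `τ : G → GL_n(k)` with constant
trace is trivial (Burnside: `k⟨τ(G)⟩ = M_n(k)`, the tree's `span_eq_top_iff_forall_isIrreducible`;
then `tr((τ(g₀) - 1)M) = 0` for all `M`). [folklore] -/
theorem eq_one_of_isAbsIrreducible_of_trace_const (hn : 0 < n) (τ : G →* GL (Fin n) k)
    (habs : IsAbsIrreducible τ) (c : k)
    (htr : ∀ g, ((τ g : GL (Fin n) k) : Matrix (Fin n) (Fin n) k).trace = c) (g₀ : G) :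
    τ g₀ = 1 := by
  have hspan := (Literature.RepresentationTheory.Semisimple.span_eq_top_iff_forall_isIrreducible
    hn τ).2 habs
  have hu : ((τ g₀ : GL (Fin n) k) : Matrix (Fin n) (Fin n) k) - 1 = 0 := by
    refine Matrix.ext_iff_trace_mul_right.2 fun x => ?_
    rw [zero_mul, Matrix.trace_zero]
    exact trace_sub_one_mul_eq_zero_of_trace_const τ c htr g₀ x
      (by rw [hspan]; exact Submodule.mem_top)
  exact Units.ext (by rw [Units.val_one]; exact sub_eq_zero.mp hu)

/-- **Constant trace in dimension `≥ 2` excludes absolute irreducibility.** [folklore] -/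
theorem not_isAbsIrreducible_of_trace_const (hn : 2 ≤ n) (τ : G →* GL (Fin n) k) (c : k)
    (htr : ∀ g, ((τ g : GL (Fin n) k) : Matrix (Fin n) (Fin n) k).trace = c) :
    ¬ IsAbsIrreducible τ := by
  intro habs
  have hn0 : 0 < n := by omega
  have h1 : ∀ g, τ g = 1 := eq_one_of_isAbsIrreducible_of_trace_const hn0 τ habs c htr
  have hspan := (Literature.RepresentationTheory.Semisimple.span_eq_top_iff_forall_isIrreducible
    hn0 τ).2 habs
  have hle : Submodule.span k (Set.range fun g => ((τ g : GL (Fin n) k) : Matrix (Fin n) (Fin n) k))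
      ≤ k ∙ (1 : Matrix (Fin n) (Fin n) k) := by
    refine Submodule.span_le.2 ?_
    rintro _ ⟨g, rfl⟩
    simp only [h1 g, Units.val_one]
    exact Submodule.mem_span_singleton_self _
  let i : Fin n := ⟨0, by omega⟩
  let j : Fin n := ⟨1, by omega⟩
  have hij : i ≠ j := by simp [i, j, Fin.ext_iff]
  have hmem : Matrix.single i j (1 : k) ∈ k ∙ (1 : Matrix (Fin n) (Fin n) k) :=
    hle (by rw [hspan]; exact Submodule.mem_top)
  obtain ⟨a, ha⟩ := Submodule.mem_span_singleton.1 hmem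
  have h := congr_fun (congr_fun ha i) j
  simp [hij] at h

end Burnside

section TraceReduction

variable {F : Type*} [Field F] {O : ValuationSubring F} {n : ℕ} {G : Type*} [Group G]
  {k : Type*} [Field k]

/-- **The trace of a reduction is the reduction of the trace** (`IsReductionOf`). [folklore] -/
theorem trace_reduction {ι : IsLocalRing.ResidueField O →+* k} {ρ : G →* GL (Fin n) F}
    {τ : G →* GL (Fin n) k}
    (h : Literature.NumberTheory.GaloisRepresentations.IsReductionOf ι ρ τ) (g : G) :
    ∃ t : O, (t : F) = ((ρ g : GL (Fin n) F) : Matrix (Fin n) (Fin n) F).trace ∧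
      ((τ g : GL (Fin n) k) : Matrix (Fin n) (Fin n) k).trace = ι (IsLocalRing.residue O t) := by
  obtain ⟨ρ₀, Q, ⟨P, hP⟩, hQ⟩ := h
  refine ⟨((ρ₀ g : GL (Fin n) O) : Matrix (Fin n) (Fin n) O).trace, ?_, ?_⟩
  · have h1 : O.subtype (((ρ₀ g : GL (Fin n) O) : Matrix (Fin n) (Fin n) O).trace) =
        ((Matrix.GeneralLinearGroup.map O.subtype (ρ₀ g) : GL (Fin n) F) :
          Matrix (Fin n) (Fin n) F).trace := by
      rw [AddMonoidHom.map_trace]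
      rfl
    rw [ValuationSubring.subtype_apply] at h1
    rw [h1, hP g, Matrix.GeneralLinearGroup.coe_mul, Matrix.GeneralLinearGroup.coe_mul,
      Matrix.trace_units_conj']
  · rw [hQ g, Matrix.GeneralLinearGroup.coe_mul, Matrix.GeneralLinearGroup.coe_mul,
      Matrix.trace_units_conj]
    change ((Matrix.GeneralLinearGroup.map (ι.comp (IsLocalRing.residue O)) (ρ₀ g) :
      GL (Fin n) k) : Matrix (Fin n) (Fin n) k).trace = _
    rw [← RingHom.comp_apply ι (IsLocalRing.residue O), AddMonoidHom.map_trace]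
    rfl

/-- **Trace criterion for `hres`**: `tr ρ(g) ≡ c (mod 𝔪)` for all `g` (integrally witnessed)
⟹ `¬ ρ.IsResiduallyAbsIrreducible` for `ρ : Γ_K → GL₂(ℚ̄_ℓ)`.  At `ℓ = 2`, `c = 0`:
"all traces in `𝔪`" ⟹ the residual hypothesis of `DyadicEisensteinFM`. [folklore] -/
theorem not_isResiduallyAbsIrreducible_of_trace_sub_mem {K : Type*} [Field K] {ℓ : ℕ}
    [Fact ℓ.Prime] (ρ : FramedGaloisRep K (PadicAlgCl ℓ) 2) (c : padicAlgClIntegers ℓ)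
    (h : ∀ g : Field.absoluteGaloisGroup K, ∃ t : padicAlgClIntegers ℓ,
      (t : PadicAlgCl ℓ) = ((ρ g : GL (Fin 2) (PadicAlgCl ℓ)) : Matrix (Fin 2) (Fin 2) _).trace ∧
        t - c ∈ IsLocalRing.maximalIdeal (padicAlgClIntegers ℓ)) :
    ¬ ρ.IsResiduallyAbsIrreducible := by
  rintro ⟨τ, hτ, habs⟩
  refine not_isAbsIrreducible_of_trace_const le_rfl τ
    (IsLocalRing.residue (padicAlgClIntegers ℓ) c) (fun g => ?_) habs
  obtain ⟨t, ht, hτt⟩ := trace_reduction hτ g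
  obtain ⟨t', ht', hmem⟩ := h g
  have htt : t = t' := Subtype.val_injective (ht.trans ht'.symm)
  rw [hτt, RingHom.id_apply, htt]
  rw [← sub_eq_zero, ← map_sub]
  exact (IsLocalRing.residue_eq_zero_iff _).2 hmem

end TraceReduction

/-! ## §2 Hypothesis mutation: nothing is decoration here

Unlike K3 (`DyadicNonsolvableFM`: `hsol ⟹ hres ⟹ hirr`, sibling Disproof §2), for the Eisenstein
crux the hypotheses `hres` (residually NOT abs. irreducible), `hirr` (irreducible over `ℚ̄₂`),
`hodd`, a.e.-unramified, de Rham-regular are independent in nature: `ρ_{Δ,2}` has all of them;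
`1 ⊕ ε₂` has all but `hirr`; an Eisenstein-residue infinitely ramified `ρ` (Ramakrishna type) all
but a.e.-unramified; a non-classical point of the Eisenstein eigencurve all but de Rham; and
oddness, though residually INVISIBLE at `2` (§0: `det ρ̄(c) = 1` and `ρ̄^ss(c) = 1` for odd and
even `ρ` alike), is not implied by the rest by any known theorem at `ℓ = 2`.  No `_iff_minimal`
theorem is claimed. -/

/-! ## §3 Load-bearing analysis -/

/-- **The crux WITHOUT the residual hypothesis** (`hres` dropped): Fontaine–Mazur at `ℓ = 2` for
ALL irreducible odd geometric `ρ` with distinct Hodge–Tate weights — the route's target sector at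
`2`.  Status: OPEN; `withoutResiduallyReducible_iff`. -/
def DyadicEisensteinFMWithoutResiduallyReducible : Prop :=
  ∀ ρ : FramedGaloisRep ℚ (PadicAlgCl 2) 2, ρ.toGaloisRep.IsIrreducible → ρ.IsOdd →
    AEUnramified ρ → DeRhamRegularAtTwo ρ → AutomorphicAE ρ

/-- **Dropping `hres` = the three dyadic statements of the route**: by the trichotomy of `closes`
("`ρ̄` not abs. irreducible / abs. irreducible solvable / non-solvable") the crux without `hres` is
`DyadicEisensteinFM ∧ DyadicDihedralFM ∧ DyadicNonsolvableFM`.  So `hres` is load-bearing exactly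
modulo the open K2 (and the printed K3), and no `_false_without_hres` theorem can exist unless
Fontaine–Mazur fails at `2`. -/
theorem withoutResiduallyReducible_iff :
    DyadicEisensteinFMWithoutResiduallyReducible ↔
      (DyadicEisensteinFM ∧ DyadicDihedralFM ∧ DyadicNonsolvableFM) := by
  constructor
  · intro h
    refine ⟨?_, ?_, ?_⟩
    · intro ℓ _ hℓ ρ _ hirr hodd hunr hdR hcpt ι
      subst hℓ
      exact h ρ hirr hodd hunr hdR hcpt ι
    · intro ℓ _ hℓ ρ _ _ hirr hodd hunr hdR hcpt ι
      subst hℓ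
      exact h ρ hirr hodd hunr hdR hcpt ι
    · intro ℓ _ hℓ ρ _ _ hirr hodd hunr hdR hcpt ι
      subst hℓ
      exact h ρ hirr hodd hunr hdR hcpt ι
  · rintro ⟨h₁, h₂, h₄⟩ ρ hirr hodd hunr hdR hcpt ι
    by_cases hres : ρ.IsResiduallyAbsIrreducible
    · by_cases hsol : IsSolvable ρ.residualRep.range
      · exact h₂ 2 rfl ρ hres hsol hirr hodd hunr hdR hcpt ι
      · exact h₄ 2 rfl ρ hres hsol hirr hodd hunr hdR hcpt ι
    · exact h₁ 2 rfl ρ hres hirr hodd hunr hdR hcpt ι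

/-- **The crux WITHOUT irreducibility** (`hirr` dropped): every residually reducible, odd,
a.e.-unramified, de Rham-regular `ρ : Γ_ℚ → GL₂(ℚ̄₂)` — REDUCIBLE ONES INCLUDED — is
cuspidal-automorphic.  Status: FALSE in nature (`withoutIrreducible_iff` isolates the false
conjunct), no witness constructible in the tree yet (§5). -/
def DyadicEisensteinFMWithoutIrreducible : Prop :=
  ∀ ρ : FramedGaloisRep ℚ (PadicAlgCl 2) 2, ¬ ρ.IsResiduallyAbsIrreducible → ρ.IsOdd →
    AEUnramified ρ → DeRhamRegularAtTwo ρ → AutomorphicAE ρ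

/-- **The reducible residue of dropping `hirr`**: "every REDUCIBLE (over `ℚ̄₂`), residually
reducible, odd, a.e.-unramified, de Rham-regular `ρ` is Satake-compatible a.e. with a CUSPIDAL
L-algebraic `π` of `GL₂(𝔸_ℚ)`".  False in nature: `ρ = 1 ⊕ ε₂` (odd: `ε₂(c) = -1`; unramified
outside `2`; crystalline at `2` with labelled weights `{0, -1}`; `ρ̄^ss = 1 ⊕ 1`) would need a
cuspidal `π` with `arithFrobPolyOfSatake ι p 1 α_p = (X - 1)(X - p)` for a.e. `p`, i.e. Satake
parameter `α_p = {1, p⁻¹}`, i.e. `{p^{1/2}, p^{-1/2}}` for the unitary twist `π ⊗ |det|^{-1/2}` —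
excluded for cuspidal `π` by the Jacquet–Shalika bound `|α| < p^{1/2}` (J. Amer. Math. Soc. /
Amer. J. Math. 103 (1981), Cor. 2.5); equivalently `L(s, π × π^∨)` would acquire the double pole
of `ζ(s)ζ(s-1)ζ(s+1)ζ(s)`. -/
def ReducibleEisensteinAutomorphic : Prop :=
  ∀ ρ : FramedGaloisRep ℚ (PadicAlgCl 2) 2, ¬ ρ.IsResiduallyAbsIrreducible →
    ¬ ρ.toGaloisRep.IsIrreducible → ρ.IsOdd → AEUnramified ρ → DeRhamRegularAtTwo ρ →
      AutomorphicAE ρ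

/-- **Dropping `hirr` = crux ∧ (reducible Eisenstein `ρ` are cuspidal-automorphic)**; the second
conjunct is false in nature, so `hirr` is LOAD-BEARING for this crux (contrast: for K3 it was
implied by the residual hypothesis).  Pure logic (`by_cases` on irreducibility). -/
theorem withoutIrreducible_iff :
    DyadicEisensteinFMWithoutIrreducible ↔
      (DyadicEisensteinFMAtTwo ∧ ReducibleEisensteinAutomorphic) := by
  constructor
  · intro h
    exact ⟨fun ρ hres _ hodd hunr hdR => h ρ hres hodd hunr hdR,
      fun ρ hres _ hodd hunr hdR => h ρ hres hodd hunr hdR⟩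
  · rintro ⟨h, h'⟩ ρ hres hodd hunr hdR
    by_cases hirr : ρ.toGaloisRep.IsIrreducible
    · exact h ρ hres hirr hodd hunr hdR
    · exact h' ρ hres hirr hodd hunr hdR

/-- **The crux WITHOUT oddness.**  Status: OPEN, conjecturally TRUE for want of instances (an even
irreducible geometric `ρ` with distinct HT weights would, by Fontaine–Mazur + Langlands, come from
a REGULAR L-algebraic cuspidal `π` of `GL₂(𝔸_ℚ)`, whose `π_∞` is a discrete series, so `ρ` would
be odd; unconditionally, Calegari (Invent. Math. 185 (2011); JAMS 25 (2012) Thm. 1.2, the tree's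
`Calegari2011_thm_1_2`) excludes even such `ρ` only for `p > 7` and `Sym² ρ̄` irreducible — nothing
covers `ℓ = 2`, `ρ̄` reducible).  Not refutable here or in print.  Oddness IS used by every known
method (the sign/central character of the automorphic side; at odd `ℓ` also residually, through
`reduction_complexConjugation_ne_one`), yet at `ℓ = 2` it is residually invisible (§0). -/
def DyadicEisensteinFMWithoutOdd : Prop :=
  ∀ ρ : FramedGaloisRep ℚ (PadicAlgCl 2) 2, ¬ ρ.IsResiduallyAbsIrreducible →
    ρ.toGaloisRep.IsIrreducible → AEUnramified ρ → DeRhamRegularAtTwo ρ → AutomorphicAE ρ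

/-- Dropping oddness only strengthens: `WithoutOdd → AtTwo` (trivial direction; the converse is
the open non-existence of even regular geometric Eisenstein-residue `ρ` at `ℓ = 2`). -/
theorem atTwo_of_withoutOdd (h : DyadicEisensteinFMWithoutOdd) : DyadicEisensteinFMAtTwo :=
  fun ρ hres hirr _ hunr hdR => h ρ hres hirr hunr hdR

/-- **The crux WITHOUT "de Rham at `2` with distinct HT weights".**  Status: FALSE in print, no
witness constructible in the tree.  (i) Without de Rham: `AutomorphicAE ρ` forces `ρ ≅ ρ_{π,ι}`
a.e. hence (Chebotarev + Brauer–Nesbitt, `ρ` irreducible) `ρ ≅ ρ_{π,ι}` de Rham, while generic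
`ℚ̄₂`-points of an irreducible component of the Eisenstein pseudo-deformation space (or
non-classical points of the `2`-adic eigencurve through an Eisenstein-residue form) are
irreducible, odd, finitely ramified and NOT de Rham.  (ii) Keeping de Rham, dropping only `Nodup`:
equal weights = Artin-type `ρ` up to twist — weight-one Fontaine–Mazur at `p = 2` for reducible
`ρ̄`, OPEN in this phrasing (Buzzard–Taylor / Pilloni–Stroh need `p > 2`), conjecturally true (odd
Artin ⟹ weight one, Khare–Wintenberger Cor. 10.2).  `Nodup` is load-bearing for the METHOD
(Pan II classicality needs weights `0 < k`), not for truth. -/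
def DyadicEisensteinFMWithoutDeRhamRegular : Prop :=
  ∀ ρ : FramedGaloisRep ℚ (PadicAlgCl 2) 2, ¬ ρ.IsResiduallyAbsIrreducible →
    ρ.toGaloisRep.IsIrreducible → ρ.IsOdd → AEUnramified ρ → AutomorphicAE ρ

/-- Dropping the `2`-adic Hodge clause only strengthens (trivial direction). -/
theorem atTwo_of_withoutDeRhamRegular (h : DyadicEisensteinFMWithoutDeRhamRegular) :
    DyadicEisensteinFMAtTwo :=
  fun ρ hres hirr hodd hunr _ => h ρ hres hirr hodd hunr

/-- **The crux WITHOUT "unramified almost everywhere".**  See `withoutAEUnramified_iff`. -/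
def DyadicEisensteinFMWithoutAEUnramified : Prop :=
  ∀ ρ : FramedGaloisRep ℚ (PadicAlgCl 2) 2, ¬ ρ.IsResiduallyAbsIrreducible →
    ρ.toGaloisRep.IsIrreducible → ρ.IsOdd → DeRhamRegularAtTwo ρ → AutomorphicAE ρ

/-- **The conclusion re-implies "unramified a.e.", unconditionally**: the Satake clause
`SatakeFrobCompatibleAt` is conjunctive (`ρ.IsUnramifiedAt v` at cofinitely many `v`), and both
universal binders of the conclusion are instantiable in the tree — the level fact
`isCompact_glFiniteIntegralLevel_holds 2 ℚ` (PROVED) and an abstract field isomorphism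
`ℚ̄₂ ≃+* ℂ` (`PadicAlgCl.nonempty_ringEquiv_complex`, Steinitz) — so an `AutomorphicAE` `ρ` is
a.e. unramified with no extra input. [folklore] -/
theorem aeUnramified_of_automorphicAE (ρ : FramedGaloisRep ℚ (PadicAlgCl 2) 2)
    (h : AutomorphicAE ρ) : AEUnramified ρ := by
  obtain ⟨ι⟩ := PadicAlgCl.nonempty_ringEquiv_complex 2
  obtain ⟨π, -, hπ⟩ := h (isCompact_glFiniteIntegralLevel_holds 2 ℚ) ι
  exact hπ.mono fun v ⟨_, _, hρ, _⟩ => hρ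

/-- **Dropping "unramified a.e." = crux ∧ an unramifiedness assertion**: the crux without `hunr`
is equivalent to the crux together with "every continuous irreducible odd, de Rham-regular-at-`2`,
residually reducible `ρ : Γ_ℚ → GL₂(ℚ̄₂)` is unramified at all but finitely many places" — false
in nature (infinitely ramified `p`-adic representations with prescribed local behaviour:
Ramakrishna, Ann. of Math. 151 (2000); Khare–Larsen–Ramakrishna, Amer. J. Math. 127 (2005)),
though no `2`-adic Eisenstein-residue witness is in print or constructible here.  So `hunr` is
load-bearing. -/
theorem withoutAEUnramified_iff :
    DyadicEisensteinFMWithoutAEUnramified ↔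
      (DyadicEisensteinFMAtTwo ∧
        ∀ ρ : FramedGaloisRep ℚ (PadicAlgCl 2) 2, ¬ ρ.IsResiduallyAbsIrreducible →
          ρ.toGaloisRep.IsIrreducible → ρ.IsOdd → DeRhamRegularAtTwo ρ → AEUnramified ρ) := by
  constructor
  · intro h
    exact ⟨fun ρ hres hirr hodd _ hdR => h ρ hres hirr hodd hdR,
      fun ρ hres hirr hodd hdR => aeUnramified_of_automorphicAE ρ (h ρ hres hirr hodd hdR)⟩
  · rintro ⟨h, hunr⟩ ρ hres hirr hodd hdR
    exact h ρ hres hirr hodd (hunr ρ hres hirr hodd hdR) hdR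

/-! ## §4 Shape of the conclusion: the almost-everywhere form is tight -/

/-- **`SatakeFrobCompatibleAt` at `v` forces `ρ` unramified at `v`** (the clause is conjunctive),
so the `∀ᶠ v in cofinite` of the conclusion cannot be upgraded to `∀ v` for any `ρ` ramified at
some place (every `ρ` of the crux with `ρ̄^ss ≠ 1 ⊕ 1` up to unramified twist is ramified
somewhere, and `ρ_{f,2}` for `f` = 11a is ramified at `11`): the natural "everywhere" strengthening
of the conclusion is false on the whole modular locus off level one. [folklore] -/
theorem not_satakeFrobCompatibleAt_of_not_isUnramifiedAt {hcpt : isCompact_glFiniteIntegralLevel 2 ℚ}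
    (ι : PadicAlgCl 2 ≃+* ℂ) (π : CuspidalAutomorphicRepData 2 ℚ hcpt)
    {ρ : FramedGaloisRep ℚ (PadicAlgCl 2) 2} {v : HeightOneSpectrum (𝓞 ℚ)}
    (hv : ¬ ρ.IsUnramifiedAt v) : ¬ SatakeFrobCompatibleAt ι π.1 ρ v :=
  fun ⟨_, _, hρ, _⟩ => hv hρ

/-! ## §5 Near-misses (documentation; nothing is asserted)

`¬ DyadicEisensteinFMWithoutIrreducible` (equivalently `¬ ReducibleEisensteinAutomorphic`, given
the crux) is TRUE in nature with witness `ρ = 1 ⊕ ε₂ : Γ_ℚ → GL₂(ℚ̄₂)`; a Lean proof needs, in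
tree vocabulary: (i) the global `ε₂` as a framed representation into `GL₁(ℚ̄₂)`
(`GaloisRep.cyclotomicCharacter ℚ 2 : Γ_ℚ →ₜ* ℤ₂ˣ` exists; push along `ℤ₂ → ℚ̄₂`) and the
block-diagonal framing `1 ⊕ ε₂ : Γ_ℚ →ₜ* GL₂(ℚ̄₂)` (no `FramedRep.prod` in the tree);
(ii) `IsOdd`: `ε₂(c) = -1` (complex conjugation inverts roots of unity under any `ι : ℚ̄ → ℂ`;
Mathlib `cyclotomicCharacter.spec`); (iii) unramified outside `2` (inertia at `p ≠ 2` fixes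
`2`-power roots of unity: separability of `X^{2^n} - 1` mod `p`); (iv) `DeRhamRegularAtTwo`:
de Rham for the PINNED datum holds for unramified and cyclotomic representations WITHOUT
`FontaineDatumExists` (`FontaineDpst`: `BdRUnramified`, `BdRCyclotomic`), but the labelled weights
of a DIRECT SUM (`{0} + {-1}`, `Nodup`) are not in the tree ("behaviour under direct sums: NOT
here", `LabelledHodgeTateWeights`); (v) `¬ IsResiduallyAbsIrreducible`: every reduction has all
characteristic polynomials `(X - 1)²`, and an absolutely irreducible such `τ` would be equivalent
to `1 ⊕ 1` by Brauer–Nesbitt (`brauerNesbitt_holds`) — contradiction — or, cheaper, by the trace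
criterion of §1b (`tr(1 ⊕ ε₂)(g) = 1 + ε₂(g) ≡ 0 (mod 𝔪)` since `ε₂ ≡ 1`:
`not_isResiduallyAbsIrreducible_of_trace_sub_mem` with `c = 0`); (vi) the decisive AUTOMORPHIC
input: no cuspidal L-algebraic `π` of `GL₂(𝔸_ℚ)` has Satake parameters `{1, p⁻¹}` at a.e. `p`.
FINDING (cycle 1): the tree PROVES Jacquet–Shalika's strict bound in ranks `≤ 2` on the `L²` side —
`Literature.NumberTheory.Automorphic.norm_satakeParameter_lt_sqrt_of_le_two` (axioms `propext`,
`Classical.choice`, `Quot.sound` only; file `PairLFunctionPolesRankNeAssembly`): for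
`P : CuspidalAutomorphicRepGL n K μ`, `IsSatakeFamilyOf P S α`, `v ∉ S`, `a ∈ α v`:
`‖a‖ < √q_v`.  Twist-invariant use: for cuspidal `π` with unitary central character `|ab| = 1`,
so `|a|, |b| < √q` gives `1/√q < |a|, |b|` and the RATIO satisfies `q⁻¹ < |a/b| < q`; the ratio is
unchanged under `π ↦ π ⊗ |det|^s`, so the same holds for every cuspidal `π`; for `1 ⊕ ε₂` the
predicted Satake parameter is `{1, p⁻¹}` (arithmetic Frobenius polynomial `(X - 1)(X - p)`), ratio
exactly `p^{±1}` — the excluded boundary.  So (vi) holds in the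
tree MODULO the two accepted NAMED FACTS bridging the Borel–Jacquet datum of the conclusion to G19's
`L²` objects: `AutomorphicRepsGL.exists_isAssociatedL2` (needs the `A_G`-invariance normalisation,
i.e. a preliminary twist by `|det|^s`) and `hasSatakeParamAt_iff_L2` (`AutomorphicRepsGL.lean`),
plus contragredient/twist stability of cuspidality (`CuspidalAutomorphicRepData.twist`,
`CuspidalContragredient`).  Items (i)–(v) are each a day of Lean; (vi) is a negative lemma modulo
named facts, not a vendoring decision any more.  Recorded for a later cycle; not attempted in
cycle 1 (the budget rule prefers landed negatives, and this one cannot land unconditionally yet).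

NATURAL STRENGTHENINGS considered and found unrefutable here for the same reason (no witnesses):
`∃ π ∀ ι` (uniform automorphic partner — false in nature as soon as the Hecke field is not `ℚ`,
e.g. weight 2 level 23: the partner of `ρ_{f,λ}` is `π_{f^σ}` for the `σ` determined by `ι`);
Satake compatibility at EVERY place (§4); compatibility AT `v = 2` (meaningless: `ρ` may ramify). -/

/-! ## §6 Targets (lead's stuck stubs)

None yet: payload `stuck_stubs = []`; `PICKED.md` (lead, 2026-08-17) records that the only
registered artefact `SketchIdeator2.lean` is an ideation sketch, not a skeleton with stubs. -/

end Summit.Langlands.Langlands.Cruxes.DyadicEisensteinFM.Disproof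

end
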